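import Mathlib.LinearAlgebra.Matrix.Rank
import Literature.Computability.AlgebraicComplexity.OneOneOneCertificate
import Literature.Computability.AlgebraicComplexity.KoszulFlatteningKronecker
import Literature.LinearAlgebra.Matrix.IntRowCertificate
import HarnessLib

/-!
# Jelisiejew–Landsberg–Pal 2023: concise tensors of minimal border rank (`m ≤ 5`; `1_*`-generic, `m ≤ 6`) — two NAMED FACTS and an integer 111-abundance certificate

Topic `Literature/Computability/AlgebraicComplexity`.  Two NAMED FACTS (`def … : Prop`, D-0014, used as
hypotheses, not proved here) — Theorems 1.5 and 1.3 of Jelisiejew–Landsberg–Pal, *Concise tensors of minimal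
border rank*, Math. Ann. 388 (2023) — the notions they are stated over (`IsConcise3`, `Is111Abundant`,
`IsOneStarGeneric`; `IsOneAGeneric` is the tree's), and a kernel-decidable INTEGER CERTIFICATE (`JLPCert.check15`,
`JLPCert.checkOneA`) whose soundness theorems turn a `decide`d Boolean into the hypotheses of the facts, hence
into `bR(S ⊗ ℂ) ≤ m` for an explicit concise integer tensor `S` of format `m × m × m` GIVEN the fact, and — by
monotonicity of border rank under restriction (`algBorderRank_precomp_le`) — into `bR(T ⊗ ℂ) ≤ m` for every
sub-tensor `T` of `S`.  Written for the pub-tensor border-rank tables (unit b2b-tensor-1, gen 10): the bundle's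
41 rows "decided by theorem (upper side)" are exactly of this shape (a `4 × 4 × 4` row tensor `T` with a
kernel-certified lower bound `m ≤ bR(T)` and a concise `(m,m,m)` integer EXTENSION `S ⊇ T` satisfying the
111-equations), see `SmallTensorBorderRankJLPExtension.lean`.
HONEST FRAMING (verbatim from the bundle): the value here is a THEOREM / DECIDABLE VERDICT / CERTIFICATE about
explicit SMALL tensors — entries of a border-rank table — NOT progress on the exponent of matrix multiplication;
the laser-method barriers are untouched by anything in this file.

THE NOTIONS (JLP23 §1.1; tensors `t ∈ K^Z ⊗ K^X ⊗ K^Y` as maps `t : Z → X → Y → K`).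
* `IsConcise3 t`: `t` is `A`-, `B`- and `C`-concise — the three slice families `(t z)_z`, `(t · x ·)_x`,
  `(t · · y)_y` are linearly independent (JLP23 §1.1: "`T` is `A`-concise if the map `T_A : A* → B ⊗ C` is
  injective"); phrased with the tree's `rotate` exactly as the hypotheses of
  `exists_linearIndependent_lin111_of_algBorderRank_le` (`OneOneOneEquations.lean`).
* `Is111Abundant m t`: the 111-space `𝔞(t) = ker (lin111 t) = {(P,Q,R) | P ·₁ t = Q ·₂ t = R ·₃ t}` (the
  "111-algebra" of JLP23 Def. 1.9, `MatMulDirectSumCubicFormat.lean`) contains `m` linearly independent triples.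
  JLP23 define 111-abundance as `dim ((T(A*)⊗A) ∩ (T(B*)⊗B) ∩ (T(C*)⊗C)) ≥ m` (display (111-abundance), §1.1);
  for CONCISE `t` the triple intersection is `𝔞(t) · t` and `𝔞(t) → 𝔞(t) · t` is a bijection (JLP23 Thm. 1.10
  and the sentence after it: the projection of the 111-algebra to any factor is injective; conciseness makes
  `P ↦ P ·₁ t` injective), so the two dimensions agree, and "when `T` is concise this condition is equivalent to
  requiring that … the map (1.1) has rank at most `3m² - m`", i.e. to the 111-EQUATIONS (JLP23 §1.1, the
  paragraph after the display).  Both facts below are applied to concise tensors only.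
* `IsOneAGeneric t` is the tree's (`KoszulFlatteningKronecker.lean`, CGLV 2022 §3.2 = JLP23 §1.1: "`T` is
  `1_A`-generic if `T(A*) ⊆ B ⊗ C` contains an element of rank `m`", `dim B = dim C = m`; some contraction
  `T(α) = contractFirst α t` has full rank); `IsOneStarGeneric t`: `1_A`-, `1_B`- or `1_C`-generic ("at least
  one of"), via `rotate`.

THE FACTS (stated over `ℂ`, verbatim the paper's field; border rank = the tree's `algBorderRank`, the algebraic
`K[ε]`-definition of Bläser 2013 Def. 6.1 / BCS Def. (15.19), which over `ℂ` is the classical border rank,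
BCS (20.5)/(20.3)).
* `JLP2023_thm_1_5` — Thm. 1.5: "When `m ≤ 5`, the set of concise minimal border rank tensors in
  `ℂ^m ⊗ ℂ^m ⊗ ℂ^m` is the zero set of the 111-equations."  We state the direction used: a concise tensor
  satisfying the 111-equations (⇔ 111-abundant, see above) has border rank `≤ m` (hence `= m`, conciseness).
* `JLP2023_thm_1_3` — Thm. 1.3: "Let `m ≤ 6` and consider the set of tensors in `ℂ^m ⊗ ℂ^m ⊗ ℂ^m` which are
  `1_*`-generic and concise.  The following subsets coincide: (1) the zero set of Strassen's equations and the
  End-closed equations, (2) 111-abundant tensors, (3) 111-sharp tensors, (4) minimal border rank tensors."  We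
  state (2) ⊆ (4).
The converse direction (minimal border rank ∧ concise ⇒ 111-abundant; Buczyńska–Buczyński 2021 Thm. 1.2) is a
THEOREM of the tree over every field (`exists_linearIndependent_lin111_of_algBorderRank_le`); we record it in the
present vocabulary (`is111Abundant_of_algBorderRank_le`) and the resulting equivalence under the fact
(`algBorderRank_le_iff_is111Abundant_of_JLP15`).

THE CERTIFICATE (`namespace JLPCert`; integer tensor `S : Fin n → Fin n → Fin n → ℤ`, read in a field `F` of
characteristic zero).  `check15 n S r₁ p₁ r₂ p₂ r₃ p₃ G rG pG` is the conjunction of: three integer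
row-operation certificates (`Literature.LinearAlgebra.Matrix.intTriCheck`) that the three flattenings of `S`
have rank `≥ n` (⇒ `IsConcise3 (S ⊗ F)`, `linearIndependent_of_card_le_rank_slab₁`); `kerCheck`: each of the
`n` listed integer vectors `G[k] ∈ ℤ^{3n²}` (a triple `(P,Q,R)` flattened in the column order of `colCode111`)
satisfies `P ·₁ S = Q ·₂ S = R ·₃ S` exactly over `ℤ` (list arithmetic on codes, `csum`); and a row-operation
certificate that the `n × 3n²` integer matrix with rows `G[k]` has rank `≥ n` (⇒ the `n` kernel vectors are
linearly independent over `F`).  Soundness: `isConcise3_of_check15`, `is111Abundant_of_check15`, hence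
`algBorderRank_le_of_check15 : check15 5̱… = true → JLP2023_thm_1_5 → bR(S ⊗ ℂ) ≤ n` (`n ≤ 5`) and, with a
`1_A`-genericity certificate `checkOneA n S α rows piv` (the integer matrix `∑_z α_z S(z,·,·)` has rank `n`),
`algBorderRank_le_of_check13` (`n ≤ 6`).  `restrictCheck n a b c S T` checks on codes that `T` is the
restriction of `S` to `[a] × [b] × [c]` (initial indices); `algBorderRank_le_of_check15_restrict` /
`…check13_restrict` conclude `bR(T ⊗ ℂ) ≤ n`.  All checks are closed Boolean computations meant for
`decide +kernel`; nothing in the soundness proofs is specific to the bundle.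

## References

* J. Jelisiejew, J. M. Landsberg, A. Pal, *Concise tensors of minimal border rank*, Math. Ann. 388 (2023)
  2473–2517, doi:10.1007/s00208-023-02569-y, arXiv:2205.05713: §1.1 (conciseness, `1_A`/`1_*`-genericity, the
  111-map (1.1), 111-abundance), Thm. 1.3, Thm. 1.5, Def. 1.9 / Thm. 1.10 (111-algebra). [JelisiejewLandsbergPal2023]
* W. Buczyńska, J. Buczyński, *Apolarity, border rank, and multigraded Hilbert scheme*, Duke Math. J. 170
  (2021), Thm. 1.2 (the 111-equations vanish on concise tensors of minimal border rank). [BuczynskaBuczynski2021]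
* A. Conner, F. Gesmundo, J. M. Landsberg, E. Ventura, *Rank and border rank of Kronecker powers of tensors and
  Strassen's laser method*, Comput. Complexity 31 (2022), §3.2 (`1_A`-genericity; the tree's `IsOneAGeneric`).
  [ConnerGesmundoLandsbergVentura2022]
* M. Bläser, *Fast Matrix Multiplication*, Theory of Computing Graduate Surveys 5 (2013), Def. 6.1 (the
  `ε`-definition of border rank = `algBorderRank`), §5.1 (permutations of the factors). [Blaser2013]
* P. Bürgisser, M. Clausen, M. A. Shokrollahi, *Algebraic Complexity Theory*, Springer (1997), Def. (15.19),
  (20.3), (20.5) (border rank over `ℂ`). [BurgisserClausenShokrollahi1997]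
-/

open scoped BigOperators Matrix
open Matrix

namespace Literature.Computability.AlgebraicComplexity

open Literature.LinearAlgebra.Matrix

universe u

/-! ## The notions -/

section Notions

variable {K : Type u} [Field K] {Z X Y : Type*} [Fintype Z] [Fintype X] [Fintype Y]

/-- **Conciseness** of `t ∈ K^Z ⊗ K^X ⊗ K^Y` in all three factors: the slices `(t z)_z`, `(t · x ·)_x`,
`(t · · y)_y` are linearly independent families (equivalently the three flattening maps are injective).
[cite: JelisiejewLandsbergPal2023, §1.1 (A-, B-, C-concise)] -/
def IsConcise3 (t : Z → X → Y → K) : Prop :=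
  LinearIndependent K (fun z => t z) ∧ LinearIndependent K (fun x => rotate t x) ∧
    LinearIndependent K (fun y => rotate (rotate t) y)

/-- **111-abundance** (kernel form): the 111-space `𝔞(t) = ker (lin111 t)` of triples `(P, Q, R)` with
`P ·₁ t = Q ·₂ t = R ·₃ t` contains `m` linearly independent triples.  For concise `t` this is JLP's
`dim (triple intersection) ≥ m` (the triple intersection is `𝔞(t) · t ≅ 𝔞(t)`, JLP23 Thm. 1.10), equivalently
"the 111-equations are satisfied" (rank of the 111-map `≤ 3m² - m`).
[cite: JelisiejewLandsbergPal2023, §1.1 (display (111-abundance)); Def. 1.9, Thm. 1.10] -/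
def Is111Abundant (m : ℕ) (t : Z → X → Y → K) : Prop :=
  ∃ g : Fin m → TripleIndex Z X Y → K, LinearIndependent K g ∧ ∀ i, lin111 t (g i) = 0

/-- **`1_*`-genericity**: `t` is `1_A`-, `1_B`- or `1_C`-generic (the latter two as `1_A`-genericity — the tree's
`IsOneAGeneric`, CGLV 2022 §3.2: `dim B = dim C` and some `T(α) ∈ B ⊗ C` has full rank — of the cyclic rotations
`rotate t ∈ K^X ⊗ K^Y ⊗ K^Z`, `rotate (rotate t)`).
[cite: JelisiejewLandsbergPal2023, §1.1 (1_*-generic)] [cite: ConnerGesmundoLandsbergVentura2022, §3.2 (p. 10)]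
[cite: Blaser2013, §5.1] -/
def IsOneStarGeneric (t : Z → X → Y → K) : Prop :=
  IsOneAGeneric t ∨ IsOneAGeneric (rotate t) ∨ IsOneAGeneric (rotate (rotate t))

/-- `1_A`-generic tensors are `1_*`-generic. [cite: JelisiejewLandsbergPal2023, §1.1] -/
theorem isOneStarGeneric_of_isOneAGeneric {t : Z → X → Y → K} (h : IsOneAGeneric t) : IsOneStarGeneric t :=
  Or.inl h

/-- `1_B`-generic tensors are `1_*`-generic. [cite: JelisiejewLandsbergPal2023, §1.1] -/
theorem isOneStarGeneric_of_rotate {t : Z → X → Y → K} (h : IsOneAGeneric (rotate t)) :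
    IsOneStarGeneric t :=
  Or.inr (Or.inl h)

/-- `1_C`-generic tensors are `1_*`-generic. [cite: JelisiejewLandsbergPal2023, §1.1] -/
theorem isOneStarGeneric_of_rotate_rotate {t : Z → X → Y → K} (h : IsOneAGeneric (rotate (rotate t))) :
    IsOneStarGeneric t :=
  Or.inr (Or.inr h)

/-- **The proved direction** (Buczyńska–Buczyński; in the tree over every field): a concise tensor of format
`m × m × m` with `bR ≤ m` is 111-abundant.
[cite: BuczynskaBuczynski2021, Thm. 1.2] [cite: JelisiejewLandsbergPal2023, §1.1] -/
theorem is111Abundant_of_algBorderRank_le [DecidableEq Z] [DecidableEq X] [DecidableEq Y] {m : ℕ}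
    (t : Z → X → Y → K) (hc : IsConcise3 t) (hZ : Fintype.card Z = m) (hX : Fintype.card X = m)
    (hY : Fintype.card Y = m) (h : algBorderRank t ≤ m) : Is111Abundant m t :=
  exists_linearIndependent_lin111_of_algBorderRank_le K t hc.1 hc.2.1 hc.2.2 hZ hX hY h

end Notions

/-! ## The named facts -/

/-- **Jelisiejew–Landsberg–Pal 2023, Theorem 1.5** (the direction used).  "When `m ≤ 5`, the set of concise
minimal border rank tensors in `ℂ^m ⊗ ℂ^m ⊗ ℂ^m` is the zero set of the 111-equations."  For a concise tensor
the 111-equations are equivalent to 111-abundance (JLP23 §1.1), so: a concise, 111-abundant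
`t ∈ ℂ^m ⊗ ℂ^m ⊗ ℂ^m`, `m ≤ 5`, has border rank `≤ m` (border rank in the algebraic sense of Bläser 2013
Def. 6.1 = `algBorderRank`, which over `ℂ` is the classical notion, BCS (20.5)).  A named fact used as a
hypothesis (D-0014); not proved here.
[cite: JelisiejewLandsbergPal2023, Thm. 1.5; §1.1 (111-equations ⇔ 111-abundant for concise T)]
[cite: Blaser2013, Def. 6.1] -/
def JLP2023_thm_1_5 : Prop :=
  ∀ (m : ℕ), m ≤ 5 → ∀ t : Fin m → Fin m → Fin m → ℂ,
    IsConcise3 t → Is111Abundant m t → algBorderRank t ≤ m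

/-- **Jelisiejew–Landsberg–Pal 2023, Theorem 1.3** (the inclusion used).  "Let `m ≤ 6` and consider the set of
tensors in `ℂ^m ⊗ ℂ^m ⊗ ℂ^m` which are `1_*`-generic and concise.  The following subsets coincide: the zero
set of Strassen's equations and the End-closed equations; 111-abundant tensors; 111-sharp tensors; minimal
border rank tensors."  Hence a concise, `1_*`-generic, 111-abundant `t ∈ ℂ^m ⊗ ℂ^m ⊗ ℂ^m`, `m ≤ 6`, has
border rank `≤ m` (`algBorderRank`, Bläser 2013 Def. 6.1).  A named fact used as a hypothesis (D-0014); not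
proved here. [cite: JelisiejewLandsbergPal2023, Thm. 1.3] [cite: Blaser2013, Def. 6.1] -/
def JLP2023_thm_1_3 : Prop :=
  ∀ (m : ℕ), m ≤ 6 → ∀ t : Fin m → Fin m → Fin m → ℂ,
    IsConcise3 t → IsOneStarGeneric t → Is111Abundant m t → algBorderRank t ≤ m

/-- Under Thm. 1.5 the characterisation is an equivalence for concise tensors (`m ≤ 5`): `bR(t) ≤ m` iff `t` is
111-abundant — the forward direction being the tree's theorem `is111Abundant_of_algBorderRank_le`.
[cite: JelisiejewLandsbergPal2023, Thm. 1.5] [cite: BuczynskaBuczynski2021, Thm. 1.2] -/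
theorem algBorderRank_le_iff_is111Abundant_of_JLP15 (h : JLP2023_thm_1_5) {m : ℕ} (hm : m ≤ 5)
    (t : Fin m → Fin m → Fin m → ℂ) (hc : IsConcise3 t) : algBorderRank t ≤ m ↔ Is111Abundant m t :=
  ⟨fun hR => is111Abundant_of_algBorderRank_le t hc (Fintype.card_fin m) (Fintype.card_fin m)
    (Fintype.card_fin m) hR, h m hm t hc⟩

/-! ## The integer certificate -/

namespace JLPCert

/-! ### List arithmetic on codes -/

/-- Partial sums `f 0 + ⋯ + f (k - 1)` over `ℤ`. [folklore] -/
def csum (f : ℕ → ℤ) : ℕ → ℤ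
  | 0 => 0
  | k + 1 => csum f k + f k

/-- `csum f k = ∑_{i < k} f i`. [folklore] -/
theorem csum_eq_sum_range (f : ℕ → ℤ) : ∀ k, csum f k = ∑ i ∈ Finset.range k, f i
  | 0 => by simp [csum]
  | k + 1 => by rw [csum, csum_eq_sum_range f k, Finset.sum_range_succ]

/-- `csum f n` as a sum over `Fin n`. [folklore] -/
theorem csum_eq_sum_fin (f : ℕ → ℤ) (n : ℕ) : csum f n = ∑ i : Fin n, f i := by
  rw [csum_eq_sum_range, Fin.sum_univ_eq_sum_range]

/-- `finCode` decodes the value of an element of `Fin n` to itself. [folklore] -/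
@[simp] theorem finCode_val {n : ℕ} [NeZero n] (i : Fin n) : finCode n i.val = i :=
  Fin.ext (Nat.mod_eq_of_lt i.isLt)

/-- `finCode n a = ⟨a, _⟩` for `a < n`. [folklore] -/
theorem finCode_of_lt {n : ℕ} [NeZero n] {a : ℕ} (h : a < n) : finCode n a = ⟨a, h⟩ :=
  Fin.ext (Nat.mod_eq_of_lt h)

/-- Column ENCODER of a flattened triple `(P, Q, R)`, inverse to `colCode111` on codes `< 3n²`: `P`-block
`(i, j) ↦ i n + j`, `Q`-block `n² + (i n + j)`, `R`-block `2n² + (i n + j)`. [folklore] -/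
def colEnc111 (n : ℕ) : TripleIndex (Fin n) (Fin n) (Fin n) → ℕ
  | Sum.inl p => p.1.val * n + p.2.val
  | Sum.inr (Sum.inl p) => n * n + (p.1.val * n + p.2.val)
  | Sum.inr (Sum.inr p) => 2 * (n * n) + (p.1.val * n + p.2.val)

/-- The integer triple `(P, Q, R)` whose flattening is the list `L ∈ ℤ^{3n²}` (entries beyond the list are
`0`). [folklore] -/
def vecOfList (n : ℕ) (L : List ℤ) : TripleIndex (Fin n) (Fin n) (Fin n) → ℤ :=
  fun j => L.getD (colEnc111 n j) 0

/-! ### The kernel check -/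

/-- The 111-test for ONE listed triple `(P, Q, R) = vecOfList n L`: for all `(z, x, y) ∈ [n]³`,
`∑_{z'} P_{z z'} S(z',x,y) = ∑_{x'} Q_{x x'} S(z,x',y) = ∑_{y'} R_{y y'} S(z,x,y')`, computed over `ℤ` on codes.
[cite: JelisiejewLandsbergPal2023, Def. 1.9] -/
def kerCheck₁ (n : ℕ) [NeZero n] (S : Fin n → Fin n → Fin n → ℤ) (L : List ℤ) : Bool :=
  (List.range n).all fun z => (List.range n).all fun x => (List.range n).all fun y =>
    (csum (fun i => vecOfList n L (Sum.inl (finCode n z, finCode n i)) *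
        S (finCode n i) (finCode n x) (finCode n y)) n ==
      csum (fun i => vecOfList n L (Sum.inr (Sum.inl (finCode n x, finCode n i))) *
        S (finCode n z) (finCode n i) (finCode n y)) n) &&
    (csum (fun i => vecOfList n L (Sum.inr (Sum.inl (finCode n x, finCode n i))) *
        S (finCode n z) (finCode n i) (finCode n y)) n ==
      csum (fun i => vecOfList n L (Sum.inr (Sum.inr (finCode n y, finCode n i))) *
        S (finCode n z) (finCode n x) (finCode n i)) n)

/-- The 111-test for the first `m` listed triples `G[0], …, G[m-1]`. [cite: JelisiejewLandsbergPal2023, Def. 1.9] -/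
def kerCheck (n m : ℕ) [NeZero n] (S : Fin n → Fin n → Fin n → ℤ) (G : List (List ℤ)) : Bool :=
  (List.range m).all fun k => kerCheck₁ n S (G.getD k [])

/-- The `m × 3n²` integer matrix whose rows are the listed triples. [folklore] -/
def gramRows (n m : ℕ) (G : List (List ℤ)) : Matrix (Fin m) (TripleIndex (Fin n) (Fin n) (Fin n)) ℤ :=
  fun k j => vecOfList n (G.getD k.val []) j

/-- The matrix `∑_z α_z S(z, ·, ·)` of a listed integer combination of the `A`-slices. [folklore] -/
def combSlice (n : ℕ) [NeZero n] (S : Fin n → Fin n → Fin n → ℤ) (α : List ℤ) : Matrix (Fin n) (Fin n) ℤ :=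
  fun x y => csum (fun i => α.getD i 0 * S (finCode n i) x y) n

/-- **The Thm-1.5 certificate**: flattening ranks `≥ n` in the three directions (conciseness), `n` listed
integer triples in the 111-space, and their `n × 3n²` matrix of rank `≥ n` (independence) — five closed
integer computations. [cite: JelisiejewLandsbergPal2023, Thm. 1.5; §1.1] -/
def check15 (n : ℕ) [NeZero n] (S : Fin n → Fin n → Fin n → ℤ) (r₁ : List (List (ℕ × ℤ))) (p₁ : List ℕ)
    (r₂ : List (List (ℕ × ℤ))) (p₂ : List ℕ) (r₃ : List (List (ℕ × ℤ))) (p₃ : List ℕ) (G : List (List ℤ))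
    (rG : List (List (ℕ × ℤ))) (pG : List ℕ) : Bool :=
  intTriCheck n (fun r c => slab₁ S (finCode n r) (slabColCode n c)) r₁ p₁ &&
  intTriCheck n (fun r c => slab₁ (rotate S) (finCode n r) (slabColCode n c)) r₂ p₂ &&
  intTriCheck n (fun r c => slab₁ (rotate (rotate S)) (finCode n r) (slabColCode n c)) r₃ p₃ &&
  kerCheck n n S G &&
  intTriCheck n (fun r c => gramRows n n G (finCode n r) (colCode111 n c)) rG pG

/-- **The `1_A`-genericity certificate**: the integer matrix `∑_z α_z S(z, ·, ·)` has rank `≥ n` (row-operation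
certificate). [cite: JelisiejewLandsbergPal2023, §1.1 (1_A-generic)] -/
def checkOneA (n : ℕ) [NeZero n] (S : Fin n → Fin n → Fin n → ℤ) (α : List ℤ) (rows : List (List (ℕ × ℤ)))
    (piv : List ℕ) : Bool :=
  intTriCheck n (fun r c => combSlice n S α (finCode n r) (finCode n c)) rows piv

/-- **Restriction test**: `T(i, j, l) = S(i, j, l)` for all `(i, j, l) ∈ [a] × [b] × [c]`, on codes (meant for
`a, b, c ≤ n`: `T` is the restriction of `S` to the initial indices). [folklore] -/
def restrictCheck (n a b c : ℕ) [NeZero n] [NeZero a] [NeZero b] [NeZero c] (S : Fin n → Fin n → Fin n → ℤ)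
    (T : Fin a → Fin b → Fin c → ℤ) : Bool :=
  (List.range a).all fun i => (List.range b).all fun j => (List.range c).all fun l =>
    T (finCode a i) (finCode b j) (finCode c l) == S (finCode n i) (finCode n j) (finCode n l)

/-! ### Soundness -/

section Sound

variable {F : Type u} [Field F] {n : ℕ} [NeZero n]

/-- Rows of a matrix of rank `≥ #rows` are linearly independent. [folklore] -/
theorem linearIndependent_rows_of_card_le_rank {m κ : Type*} [Fintype m] [Fintype κ] (M : Matrix m κ F)
    (h : Fintype.card m ≤ M.rank) : LinearIndependent F (fun i => M i) := by
  classical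
  rw [Matrix.rank_eq_finrank_span_row] at h
  have hrow : LinearIndependent F M.row :=
    linearIndependent_iff_card_le_finrank_span.2 (by simpa [Set.finrank] using h)
  exact hrow

/-- A flattening-rank certificate gives linear independence of the slices (one direction of conciseness), in
characteristic zero. [cite: JelisiejewLandsbergPal2023, §1.1 (A-concise)] -/
theorem linearIndependent_slices_of_intTriCheck [CharZero F] (S : Fin n → Fin n → Fin n → ℤ)
    {rows : List (List (ℕ × ℤ))} {piv : List ℕ}
    (h : intTriCheck n (fun r c => slab₁ S (finCode n r) (slabColCode n c)) rows piv = true) :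
    LinearIndependent F (fun z => fun x y => (S z x y : F)) := by
  have hr := le_rank_of_intTriCheck (F := F) (slab₁ S) (finCode n) (slabColCode n) h
  have e : (slab₁ S).map (Int.cast : ℤ → F) = slab₁ (fun z x y => (S z x y : F)) := by
    have h' := slab₁_map (Int.castRingHom F) S
    rwa [Int.coe_castRingHom] at h'
  rw [e] at hr
  exact linearIndependent_of_card_le_rank_slab₁ _ (by rw [Fintype.card_fin]; exact hr)

/-- What `kerCheck₁` says: the listed triple lies in the 111-space of `S ⊗ R`, any commutative ring `R`.
[cite: JelisiejewLandsbergPal2023, Def. 1.9] -/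
theorem lin111_vecOfList_eq_zero {R : Type*} [CommRing R] {S : Fin n → Fin n → Fin n → ℤ} {L : List ℤ}
    (h : kerCheck₁ n S L = true) :
    lin111 (fun a b c => (S a b c : R)) (fun j => (vecOfList n L j : R)) = 0 := by
  rw [lin111_eq_zero_iff]
  unfold kerCheck₁ at h
  simp only [List.all_eq_true, List.mem_range, Bool.and_eq_true, beq_iff_eq] at h
  constructor
  · funext z x y
    obtain ⟨h1, -⟩ := h z.val z.isLt x.val x.isLt y.val y.isLt
    rw [csum_eq_sum_fin, csum_eq_sum_fin] at h1
    simp only [finCode_val] at h1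
    have h2 := congrArg (Int.cast : ℤ → R) h1
    simpa only [contract₁_apply, contract₂_apply, Int.cast_sum, Int.cast_mul] using h2
  · funext z x y
    obtain ⟨-, h1⟩ := h z.val z.isLt x.val x.isLt y.val y.isLt
    rw [csum_eq_sum_fin, csum_eq_sum_fin] at h1
    simp only [finCode_val] at h1
    have h2 := congrArg (Int.cast : ℤ → R) h1
    simpa only [contract₂_apply, contract₃_apply, Int.cast_sum, Int.cast_mul] using h2

/-- `check15 ⇒` conciseness of `S ⊗ F` (characteristic zero). [cite: JelisiejewLandsbergPal2023, §1.1] -/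
theorem isConcise3_of_check15 [CharZero F] {S : Fin n → Fin n → Fin n → ℤ} {r₁ r₂ r₃ rG : List (List (ℕ × ℤ))}
    {p₁ p₂ p₃ pG : List ℕ} {G : List (List ℤ)} (h : check15 n S r₁ p₁ r₂ p₂ r₃ p₃ G rG pG = true) :
    IsConcise3 (fun a b c => (S a b c : F)) := by
  unfold check15 at h
  simp only [Bool.and_eq_true] at h
  obtain ⟨⟨⟨⟨h₁, h₂⟩, h₃⟩, -⟩, -⟩ := h
  unfold IsConcise3
  exact ⟨linearIndependent_slices_of_intTriCheck S h₁, linearIndependent_slices_of_intTriCheck (rotate S) h₂,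
    linearIndependent_slices_of_intTriCheck (rotate (rotate S)) h₃⟩

/-- `check15 ⇒` 111-abundance of `S ⊗ F` (characteristic zero): the `n` listed integer triples are in the
111-space and linearly independent. [cite: JelisiejewLandsbergPal2023, §1.1 (111-abundance); Def. 1.9] -/
theorem is111Abundant_of_check15 [CharZero F] {S : Fin n → Fin n → Fin n → ℤ}
    {r₁ r₂ r₃ rG : List (List (ℕ × ℤ))} {p₁ p₂ p₃ pG : List ℕ} {G : List (List ℤ)}
    (h : check15 n S r₁ p₁ r₂ p₂ r₃ p₃ G rG pG = true) : Is111Abundant n (fun a b c => (S a b c : F)) := by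
  unfold check15 at h
  simp only [Bool.and_eq_true] at h
  obtain ⟨⟨-, hK⟩, hG⟩ := h
  unfold Is111Abundant
  refine ⟨fun k j => ((gramRows n n G) k j : F), ?_, fun k => ?_⟩
  · have hr := le_rank_of_intTriCheck (F := F) (gramRows n n G) (finCode n) (colCode111 n) hG
    exact linearIndependent_rows_of_card_le_rank ((gramRows n n G).map (Int.cast : ℤ → F))
      (by rw [Fintype.card_fin]; exact hr)
  · unfold kerCheck at hK
    rw [List.all_eq_true] at hK
    exact lin111_vecOfList_eq_zero (hK k.val (List.mem_range.2 k.isLt))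

/-- `checkOneA ⇒` `1_A`-genericity of `S ⊗ F` (characteristic zero): the listed contraction `∑_z α_z S(z,·,·)`
has full rank `n`. [cite: JelisiejewLandsbergPal2023, §1.1 (1_A-generic)]
[cite: ConnerGesmundoLandsbergVentura2022, §3.2 (p. 10)] -/
theorem isOneAGeneric_of_checkOneA [CharZero F] {S : Fin n → Fin n → Fin n → ℤ} {α : List ℤ}
    {rows : List (List (ℕ × ℤ))} {piv : List ℕ} (h : checkOneA n S α rows piv = true) :
    IsOneAGeneric (fun a b c => (S a b c : F)) := by
  unfold IsOneAGeneric
  refine ⟨rfl, fun z => (α.getD z.val 0 : F), ?_⟩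
  have hr := le_rank_of_intTriCheck (F := F) (combSlice n S α) (finCode n) (finCode n) h
  have e : contractFirst (fun z : Fin n => (α.getD z.val 0 : F)) (fun a b c => (S a b c : F)) =
      (combSlice n S α).map (Int.cast : ℤ → F) := by
    ext x y
    simp only [contractFirst_apply, Matrix.map_apply, combSlice, csum_eq_sum_fin, finCode_val, Int.cast_sum,
      Int.cast_mul]
  rw [e, Fintype.card_fin]
  exact le_antisymm ((Matrix.rank_le_card_height _).trans (Fintype.card_fin n).le) hr

/-- What `restrictCheck` says: `T` is the restriction of `S` along the initial-segment embeddings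
`Fin.castLE`. [folklore] -/
theorem restrict_eq_of_restrictCheck {a b c : ℕ} [NeZero a] [NeZero b] [NeZero c]
    {S : Fin n → Fin n → Fin n → ℤ} {T : Fin a → Fin b → Fin c → ℤ} (h : restrictCheck n a b c S T = true)
    (ha : a ≤ n) (hb : b ≤ n) (hc : c ≤ n) :
    (fun i j l => S (Fin.castLE ha i) (Fin.castLE hb j) (Fin.castLE hc l)) = T := by
  funext i j l
  unfold restrictCheck at h
  simp only [List.all_eq_true, List.mem_range, beq_iff_eq] at h
  have h1 := h i.val i.isLt j.val j.isLt l.val l.isLt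
  rw [finCode_val, finCode_val, finCode_val, finCode_of_lt (lt_of_lt_of_le i.isLt ha),
    finCode_of_lt (lt_of_lt_of_le j.isLt hb), finCode_of_lt (lt_of_lt_of_le l.isLt hc)] at h1
  exact h1.symm

/-- **Soundness of the Thm-1.5 certificate.**  A checked `check15` for an integer `n × n × n` tensor `S`,
`n ≤ 5`, gives `bR(S ⊗ ℂ) ≤ n` GIVEN JLP23 Thm. 1.5. [cite: JelisiejewLandsbergPal2023, Thm. 1.5] -/
theorem algBorderRank_le_of_check15 (hJ : JLP2023_thm_1_5) (hn : n ≤ 5) {S : Fin n → Fin n → Fin n → ℤ}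
    {r₁ r₂ r₃ rG : List (List (ℕ × ℤ))} {p₁ p₂ p₃ pG : List ℕ} {G : List (List ℤ)}
    (h : check15 n S r₁ p₁ r₂ p₂ r₃ p₃ G rG pG = true) :
    algBorderRank (fun a b c => (S a b c : ℂ)) ≤ n :=
  hJ n hn _ (isConcise3_of_check15 h) (is111Abundant_of_check15 h)

/-- **Soundness of the Thm-1.3 certificate.**  A checked `check15` plus a `1_A`-genericity certificate for
`S`, `rotate S` or `rotate (rotate S)` (`1_*`-genericity), `n ≤ 6`, gives `bR(S ⊗ ℂ) ≤ n` GIVEN JLP23 Thm. 1.3.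
[cite: JelisiejewLandsbergPal2023, Thm. 1.3] -/
theorem algBorderRank_le_of_check13 (hJ : JLP2023_thm_1_3) (hn : n ≤ 6) {S : Fin n → Fin n → Fin n → ℤ}
    {r₁ r₂ r₃ rG : List (List (ℕ × ℤ))} {p₁ p₂ p₃ pG : List ℕ} {G : List (List ℤ)}
    (h : check15 n S r₁ p₁ r₂ p₂ r₃ p₃ G rG pG = true)
    (hg : IsOneStarGeneric (fun a b c => (S a b c : ℂ))) :
    algBorderRank (fun a b c => (S a b c : ℂ)) ≤ n :=
  hJ n hn _ (isConcise3_of_check15 h) hg (is111Abundant_of_check15 h)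

/-- `1_*`-genericity of `S ⊗ F` from a `1_A`-certificate for `S` (leg `A`). [cite: JelisiejewLandsbergPal2023, §1.1] -/
theorem isOneStarGeneric_of_checkOneA₁ [CharZero F] {S : Fin n → Fin n → Fin n → ℤ} {α : List ℤ}
    {rows : List (List (ℕ × ℤ))} {piv : List ℕ} (h : checkOneA n S α rows piv = true) :
    IsOneStarGeneric (fun a b c => (S a b c : F)) :=
  isOneStarGeneric_of_isOneAGeneric (isOneAGeneric_of_checkOneA h)

/-- `1_*`-genericity of `S ⊗ F` from a `1_A`-certificate for `rotate S` (leg `B`). [cite: JelisiejewLandsbergPal2023, §1.1] -/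
theorem isOneStarGeneric_of_checkOneA₂ [CharZero F] {S : Fin n → Fin n → Fin n → ℤ} {α : List ℤ}
    {rows : List (List (ℕ × ℤ))} {piv : List ℕ} (h : checkOneA n (rotate S) α rows piv = true) :
    IsOneStarGeneric (fun a b c => (S a b c : F)) :=
  isOneStarGeneric_of_rotate (isOneAGeneric_of_checkOneA h)

/-- `1_*`-genericity of `S ⊗ F` from a `1_A`-certificate for `rotate (rotate S)` (leg `C`). [cite: JelisiejewLandsbergPal2023, §1.1] -/
theorem isOneStarGeneric_of_checkOneA₃ [CharZero F] {S : Fin n → Fin n → Fin n → ℤ} {α : List ℤ}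
    {rows : List (List (ℕ × ℤ))} {piv : List ℕ} (h : checkOneA n (rotate (rotate S)) α rows piv = true) :
    IsOneStarGeneric (fun a b c => (S a b c : F)) :=
  isOneStarGeneric_of_rotate_rotate (isOneAGeneric_of_checkOneA h)

/-- **Restriction.**  If `T` is the restriction of `S` to `[a] × [b] × [c]` then `bR(T ⊗ R) ≤ bR(S ⊗ R)`
(monotonicity of border rank under restriction, `algBorderRank_precomp_le`). [cite: Blaser2013, Def. 6.1] -/
theorem algBorderRank_restrict_le {R : Type*} [CommRing R] {a b c : ℕ} [NeZero a] [NeZero b] [NeZero c]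
    {S : Fin n → Fin n → Fin n → ℤ} {T : Fin a → Fin b → Fin c → ℤ} (h : restrictCheck n a b c S T = true)
    (ha : a ≤ n) (hb : b ≤ n) (hc : c ≤ n) :
    algBorderRank (fun i j l => (T i j l : R)) ≤ algBorderRank (fun i j l => (S i j l : R)) := by
  rw [← restrict_eq_of_restrictCheck h ha hb hc]
  exact algBorderRank_precomp_le (fun i j l => (S i j l : R)) (Fin.castLE ha) (Fin.castLE hb) (Fin.castLE hc)

/-- **Row form, Thm. 1.5**: a `check15`-certified concise 111-abundant integer extension `S ⊇ T` of format
`n ≤ 5` gives `bR(T ⊗ ℂ) ≤ n` GIVEN JLP23 Thm. 1.5. [cite: JelisiejewLandsbergPal2023, Thm. 1.5] -/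
theorem algBorderRank_le_of_check15_restrict (hJ : JLP2023_thm_1_5) (hn : n ≤ 5)
    {S : Fin n → Fin n → Fin n → ℤ} {r₁ r₂ r₃ rG : List (List (ℕ × ℤ))} {p₁ p₂ p₃ pG : List ℕ}
    {G : List (List ℤ)} (h : check15 n S r₁ p₁ r₂ p₂ r₃ p₃ G rG pG = true) {a b c : ℕ} [NeZero a] [NeZero b]
    [NeZero c] {T : Fin a → Fin b → Fin c → ℤ} (hT : restrictCheck n a b c S T = true) (ha : a ≤ n)
    (hb : b ≤ n) (hc : c ≤ n) : algBorderRank (fun i j l => (T i j l : ℂ)) ≤ n :=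
  (algBorderRank_restrict_le hT ha hb hc).trans (algBorderRank_le_of_check15 hJ hn h)

/-- **Row form, Thm. 1.3**: a `check15`-certified concise 111-abundant `1_*`-generic integer extension `S ⊇ T`
of format `n ≤ 6` gives `bR(T ⊗ ℂ) ≤ n` GIVEN JLP23 Thm. 1.3. [cite: JelisiejewLandsbergPal2023, Thm. 1.3] -/
theorem algBorderRank_le_of_check13_restrict (hJ : JLP2023_thm_1_3) (hn : n ≤ 6)
    {S : Fin n → Fin n → Fin n → ℤ} {r₁ r₂ r₃ rG : List (List (ℕ × ℤ))} {p₁ p₂ p₃ pG : List ℕ}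
    {G : List (List ℤ)} (h : check15 n S r₁ p₁ r₂ p₂ r₃ p₃ G rG pG = true)
    (hg : IsOneStarGeneric (fun a b c => (S a b c : ℂ))) {a b c : ℕ} [NeZero a] [NeZero b] [NeZero c]
    {T : Fin a → Fin b → Fin c → ℤ} (hT : restrictCheck n a b c S T = true) (ha : a ≤ n) (hb : b ≤ n)
    (hc : c ≤ n) : algBorderRank (fun i j l => (T i j l : ℂ)) ≤ n :=
  (algBorderRank_restrict_le hT ha hb hc).trans (algBorderRank_le_of_check13 hJ hn h hg)

end Sound

end JLPCert

end Literature.Computability.AlgebraicComplexity
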